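import Summits.AtomisticToContinuum.Crystallization.Theorems.OverbindingBudgetAffineFarFieldLedgerRows

/-!
# Overbinding budget, affine far field — «LedgerWindow»: the far-field ledger for THE reference tessellation, from ROWS

Support file for `Summit.AtomisticToContinuum.Crystallization.Theses.OverbindingBudget.RobustDefectLimitWindows`
(sub-problem (2c), leaf SW♭(30), part 27V «Voronoi-cell quadrature of the far field», instance 27Vc, density + ledger side).
«CellLedgerIdeal» ★ `farField_ledger_ideal` is the far-field ledger over ABSTRACT families: per actual mover a chart `A i`, a frame
`R i`, a cell `K i`; per reference site a moved ideal cell `moveMap 0 (q j) (Rr j) '' idealCell (ℓr j) ν`.  This file instantiates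
it for the route's objects of «CollarWindow» — reference cells `refCell s ν q R j` of the placed close-packed sites, actual cells
`voronoiCell (windowAtomSet Ach ych yunc) (ych i)` of the charted atoms, letters `decide (s (k−1) = s k)` by layer — and discharges
EVERY per-mover and per-reference-site binder of the ledger from the per-site ROWS of «LedgerRows» `ledgerRows_of_star`:

* per mover `u ∈ t` (`t ⊆ Ach` a finite set of charted sites): (R-chart) `‖A u x − x‖ ≤ θ‖x‖`, (R-conf) at dilation `λ u`
  up to `m`, (R-norm) `‖A u‖ ≤ a u ≤ a` (PER-MOVER norm bound `a u` under the ledger's uniform `a`: the exclusion radius and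
  the sandwich are per mover, so the slack `σ` never pays for the dilation spread of the far field), (R-star) star fit `δ₀`,
  (R-excl) exclusion at `2(a u)(1−σ)r₀` asked of the OTHER atoms `z ≠ ych u`, (R-in), (R-out) at slack `σ`;
* once: `û`-registration of the charted atoms with `2û < ν`, `r₀ = ν/√2`, the volume dial `(1+σ)³ ≤ (1+θᵥ)(1−σ)³`;
* verbatim from the ledger (window business, not rows): the two tessellations of the window region `W` with complements
  `Uc₁` (actual) / `Uc₂` (reference), the kernel `g ∈ C⁴(U)` and its derivative majorants.

★ `farField_ledger_of_rows`: the conclusion of `farField_ledger_ideal` for these objects with `ε := θ`, `s := σ`, `θ := θᵥ` — the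
statement names NO frame, NO chart in the ideal frame and NO pattern isometry: `A' u = A u ∘ G u` and the frames `G u`, `Gr j` are
chosen inside the proof (they occur only in hypotheses of the ledger).  The seam term `√2/ν³·(∫_{Uc₂} g − ∫_{Uc₁} g)` is the
interface row's ((242) `interfaceRow_window` / (273) `interfaceRow_rows`, with `Uc₁ = collarActCore`, `Uc₂ = collarRefCore`).

[this file; Conway–Sloane, Sphere Packings ch. 2, 21]
-/

namespace Summit.AtomisticToContinuum.Crystallization.Theorems.OverbindingBudgetAffineFarFieldLedgerWindow

noncomputable section

open Set MeasureTheory Metric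
open Literature.Geometry.DiscreteGeometry Literature.MathematicalPhysics.StatisticalMechanics
open Literature.Barriers.AtomisticToContinuum (voronoiCell)
open Summit.AtomisticToContinuum.Crystallization.Theorems.OverbindingBudgetAffineFarFieldCellTaylor
open Summit.AtomisticToContinuum.Crystallization.Theorems.OverbindingBudgetAffineFarFieldCellAffine
open Summit.AtomisticToContinuum.Crystallization.Theorems.OverbindingBudgetAffineFarFieldCellMove
open Summit.AtomisticToContinuum.Crystallization.Theorems.OverbindingBudgetAffineFarFieldCellRD
open Summit.AtomisticToContinuum.Crystallization.Theorems.OverbindingBudgetAffineFarFieldCellTRD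
open Summit.AtomisticToContinuum.Crystallization.Theorems.OverbindingBudgetAffineFarFieldCellLedgerIdeal
open Summit.AtomisticToContinuum.Crystallization.Theorems.OverbindingBudgetAffineFarFieldCellVoronoiFeed
open Summit.AtomisticToContinuum.Crystallization.Theorems.OverbindingBudgetAffineFarFieldCollarSites
open Summit.AtomisticToContinuum.Crystallization.Theorems.OverbindingBudgetAffineFarFieldCollarWindow
open Summit.AtomisticToContinuum.Crystallization.Theorems.OverbindingBudgetAffineFarFieldLedgerRows

local notation "E3" => EuclideanSpace ℝ (Fin 3)
local notation "Idx" => ℤ × ℤ × ℤ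

/-- ★ support (THE FAR-FIELD LEDGER FROM ROWS): reference = placed close-packed sites (`s` Hägg, `0 < ν`, rigid motion
`(q, R)`), `r₀ = ν/√2`; actual atoms `W = windowAtomSet Ach ych yunc`, `û`-registered on `Ach` with `2û < ν`; movers `t ⊆ Ach`
(finite), reference sites `uref` (finite); letters by layer.  Per mover the rows (R-chart)/(R-conf)/(R-norm)/(R-star)/(R-excl)/
(R-in)/(R-out) at uniform `θ, m, δ₀, σ`, per-site dilation `λ u` and per-site norm bound `a u ≤ a`; the volume dial
`(1+σ)³ ≤ (1+θᵥ)(1−σ)³`; the two tessellations of the window region and the kernel data verbatim.  Conclusion = «CellLedgerIdeal»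
`farField_ledger_ideal` for the Voronoi cells of the movers and the reference cells `refCell`, with `ε := θ`, `s := σ`, `θ := θᵥ` —
frames and ideal-frame charts chosen inside. [this file: «LedgerRows» + ledger] -/
theorem farField_ledger_of_rows (hC : HasRadialMoments (rdCell 1) 16 24 (656 / 15))
    (hT : |∫ x in trdCell 1, x 0 * x 1 * x 2| ≤ 112 / 405)
    {μ : Type*} {s : ℤ → ℤ} (hs : IsHaggSeq s) {ν : ℝ} (hν : 0 < ν) (q : E3) (R : E3 ≃ₗᵢ[ℝ] E3)
    (Ach : Set Idx) (ych : Idx → E3) (yunc : μ → E3) {r₀ û : ℝ} (hr₀ : r₀ = ν / Real.sqrt 2) (hû : 2 * û < ν)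
    (hreg : ∀ u ∈ Ach, dist (ych u) (placedSite s ν q R u) ≤ û)
    (t uref : Finset Idx) (ht : ∀ u ∈ t, u ∈ Ach)
    {A : Idx → (E3 ≃L[ℝ] E3)} {lam av : Idx → ℝ} {θ m a δ₀ σ θv : ℝ}
    (hθ0 : 0 ≤ θ) (hm0 : 0 ≤ m) (hm1 : m ≤ 1) (hσ0 : 0 ≤ σ) (hσ1 : σ < 1) (hθv0 : 0 ≤ θv)
    (hθv : (1 + σ) ^ 3 ≤ (1 + θv) * (1 - σ) ^ 3)
    -- the rows, per mover
    (hθ : ∀ u ∈ t, ∀ x, ‖A u x - x‖ ≤ θ * ‖x‖)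
    (hB : ∀ u ∈ t, ∀ x x' : E3,
      |inner ℝ (A u x) (A u x') - lam u ^ 2 * inner ℝ x x'| ≤ m * lam u ^ 2 * ‖x‖ * ‖x'‖)
    (ha : ∀ u ∈ t, ‖(A u : E3 →L[ℝ] E3)‖ ≤ av u) (hav : ∀ u ∈ t, av u ≤ a)
    (hstar : ∀ u ∈ t, ∀ u', barlowSiteForm s u u' = 12 →
      u' ∈ Ach ∧ dist (ych u') (ych u + A u (placedSite s ν q R u' - placedSite s ν q R u)) ≤ δ₀)
    (hexcl : ∀ u ∈ t, ∀ z ∈ windowAtomSet Ach ych yunc, z ≠ ych u →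
      (∃ u', barlowSiteForm s u u' = 12 ∧ dist z (ych u + A u (placedSite s ν q R u' - placedSite s ν q R u)) ≤ δ₀) ∨
        2 * av u * (1 - σ) * r₀ ≤ dist z (ych u))
    (hin : ∀ u ∈ t,
      (1 - σ) * m * lam u ^ 2 * ν ^ 2 / 2 + av u * δ₀ * ((1 - σ) * r₀ + ν) ≤ σ * (1 - m) * lam u ^ 2 * ν ^ 2 / 2)
    (hout : ∀ u ∈ t, (1 + σ) * m * lam u ^ 2 * ν ^ 2 / 2 + av u * δ₀ * ((1 + σ) * r₀ + ν) + δ₀ ^ 2 / 2 <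
      σ * (1 - m) * lam u ^ 2 * ν ^ 2 / 2)
    -- the two tessellations of the window (verbatim)
    {Wr Uc₁ Uc₂ U : Set E3} {g : E3 → ℝ} {D₁ D₂ D₃ D₄ E₃ E₄ : Idx → ℝ}
    (hd₁ : AEDisjoint volume (⋃ i ∈ t, voronoiCell (windowAtomSet Ach ych yunc) (ych i)) Uc₁)
    (hc₁ : NullMeasurableSet Uc₁ volume)
    (hcov₁ : ((⋃ i ∈ t, voronoiCell (windowAtomSet Ach ych yunc) (ych i)) ∪ Uc₁ : Set E3) =ᵐ[volume] Wr)
    (hci₁ : IntegrableOn g Uc₁)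
    (hd₂ : AEDisjoint volume (⋃ j ∈ uref, refCell s ν q R j) Uc₂) (hc₂ : NullMeasurableSet Uc₂ volume)
    (hcov₂ : ((⋃ j ∈ uref, refCell s ν q R j) ∪ Uc₂ : Set E3) =ᵐ[volume] Wr) (hci₂ : IntegrableOn g Uc₂)
    -- the kernel (verbatim)
    (hU : IsOpen U) (hKU : ∀ i ∈ t, voronoiCell (windowAtomSet Ach ych yunc) (ych i) ⊆ U)
    (hKrU : ∀ j ∈ uref, refCell s ν q R j ⊆ U) (hg : ContDiffOn ℝ 4 g U)
    (h1 : ∀ i ∈ t, ‖fderiv ℝ g (ych i)‖ ≤ D₁ i) (h2 : ∀ i ∈ t, ‖iteratedFDeriv ℝ 2 g (ych i)‖ ≤ D₂ i)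
    (h3 : ∀ i ∈ t, ‖iteratedFDeriv ℝ 3 g (ych i)‖ ≤ D₃ i)
    (h4 : ∀ i ∈ t, ∀ x ∈ voronoiCell (windowAtomSet Ach ych yunc) (ych i), ‖iteratedFDeriv ℝ 4 g x‖ ≤ D₄ i)
    (e3 : ∀ j ∈ uref, ‖iteratedFDeriv ℝ 3 g (placedSite s ν q R j)‖ ≤ E₃ j)
    (e4 : ∀ j ∈ uref, ∀ x ∈ refCell s ν q R j, ‖iteratedFDeriv ℝ 4 g x‖ ≤ E₄ j) :
    |(∑ i ∈ t, (g (ych i) + ν ^ 2 / 16 / 2 * lap g (ych i)))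
        - (∑ j ∈ uref, (g (placedSite s ν q R j) + ν ^ 2 / 16 / 2 * lap g (placedSite s ν q R j)))
        - (∑ i ∈ t, ((volume (voronoiCell (windowAtomSet Ach ych yunc) (ych i))).toReal⁻¹ - Real.sqrt 2 / ν ^ 3) *
            ∫ x in voronoiCell (windowAtomSet Ach ych yunc) (ych i), g x)
        - Real.sqrt 2 / ν ^ 3 * ((∫ x in Uc₂, g x) - ∫ x in Uc₁, g x)|
      ≤ (∑ i ∈ t, (a * (ν * (1 + σ) / Real.sqrt 2) * θv * D₁ i
          + (3 * |(ν * (1 - σ)) ^ 2 / 16| * θ * (1 + a) + 3 * |(ν * (1 - σ)) ^ 2 / 16| * θv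
              + 3 * |(ν * (1 - σ)) ^ 2 / 16 - ν ^ 2 / 16| + (a * (ν * (1 + σ) / Real.sqrt 2)) ^ 2 * θv) / 2 * D₂ i
          + (idealTau (decide (s (i.1 - 1) = s i.1)) (ν * (1 - σ)) * a ^ 3
              + (a * (ν * (1 + σ) / Real.sqrt 2)) ^ 3 * θv) / 6 * D₃ i
          + (41 / 960 * (ν * (1 - σ)) ^ 4 * a ^ 4 + (a * (ν * (1 + σ) / Real.sqrt 2)) ^ 4 * θv) / 24 * D₄ i))
        + ∑ j ∈ uref, (idealTau (decide (s (j.1 - 1) = s j.1)) ν / 6 * E₃ j + 41 / 960 * ν ^ 4 / 24 * E₄ j) := by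
  -- the charts in the ideal frame and the frames, chosen per mover
  have H : ∀ u : Idx, ∃ (A' : E3 ≃L[ℝ] E3) (G : E3 ≃ₗᵢ[ℝ] E3), u ∈ t →
      ‖(A' : E3 →L[ℝ] E3) - G.toLinearIsometry.toContinuousLinearMap‖ ≤ θ ∧ ‖(A' : E3 →L[ℝ] E3)‖ ≤ a ∧
        affMap 0 (ych u) A' '' idealCell (decide (s (u.1 - 1) = s u.1)) (ν * (1 - σ)) ⊆
            voronoiCell (windowAtomSet Ach ych yunc) (ych u) ∧
          voronoiCell (windowAtomSet Ach ych yunc) (ych u) ⊆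
            affMap 0 (ych u) A' '' idealCell (decide (s (u.1 - 1) = s u.1)) (ν * (1 + σ)) := by
    intro u
    by_cases hu : u ∈ t
    · obtain ⟨A', G, -, hε', ha', -, hIn, hOut⟩ := ledgerRows_of_star hs hν q R Ach ych yunc hr₀ u (A u) hθ0 hm0 hm1
        hσ0 hσ1 (hθ u hu) (hB u hu) (ha u hu) (hstar u hu) (hexcl u hu) (hin u hu) (hout u hu)
      exact ⟨A', G, fun _ => ⟨hε', ha'.trans (hav u hu), hIn, hOut⟩⟩
    · exact ⟨ContinuousLinearEquiv.refl ℝ E3, LinearIsometryEquiv.refl ℝ E3, fun h => absurd h hu⟩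
  choose A' G hAG using H
  -- the reference frames, chosen per site
  have Hr : ∀ j : Idx, ∃ Gr : E3 ≃ₗᵢ[ℝ] E3,
      refCell s ν q R j = moveMap 0 (placedSite s ν q R j) Gr '' idealCell (decide (s (j.1 - 1) = s j.1)) ν :=
    fun j => refCell_eq_moveMap hs hν q R j
  choose Gr hGr using Hr
  have e : ∀ j, moveMap 0 (placedSite s ν q R j) (Gr j) '' idealCell (decide (s (j.1 - 1) = s j.1)) ν = refCell s ν q R j :=
    fun j => (hGr j).symm
  -- the mover cells
  have hcell : ∀ u ∈ t, IsCompact (voronoiCell (windowAtomSet Ach ych yunc) (ych u)) ∧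
      StarConvex ℝ (ych u) (voronoiCell (windowAtomSet Ach ych yunc) (ych u)) ∧
        0 < (volume (voronoiCell (windowAtomSet Ach ych yunc) (ych u))).toReal :=
    fun u hu => moverCell_of_sandwich hC _ hν hσ1 (A' u) ((hAG u hu).2.2.1) ((hAG u hu).2.2.2) hσ0
  have h := farField_ledger_ideal hC hT t uref (K := fun i => voronoiCell (windowAtomSet Ach ych yunc) (ych i)) (y := ych)
    (ℓ := fun i => decide (s (i.1 - 1) = s i.1)) (A := A') (R := G) (q := placedSite s ν q R)
    (ℓr := fun j => decide (s (j.1 - 1) = s j.1)) (Rr := Gr) (E₃ := E₃) (E₄ := E₄) (W := Wr) (Uc₁ := Uc₁) (Uc₂ := Uc₂)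
    (U := U) (g := g) (D₁ := D₁) (D₂ := D₂) (D₃ := D₃) (D₄ := D₄) hν hσ0 hσ1 hθv0 hθv
    (fun i hi => (hAG i hi).1) (fun i hi => (hAG i hi).2.1) (fun i hi => (hcell i hi).1) (fun i hi => (hcell i hi).2.1)
    (fun i hi => (hcell i hi).2.2) (fun i hi => (hAG i hi).2.2.1) (fun i hi => (hAG i hi).2.2.2)
    (fun i hi i' hi' hne => aedisjoint_cell_of_reg hs hν q R Ach ych yunc hû hreg (ht i hi) (ht i' hi') hne)
    (fun j hj j' hj' hne => by
      beta_reduce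
      rw [e, e]
      exact aedisjoint_voronoiCell (mem_range_self j) (mem_range_self j') ((placedSite_injective hs hν).ne hne))
    hd₁ hc₁ hcov₁ hci₁ (by simp_rw [e]; exact hd₂) hc₂ (by simp_rw [e]; exact hcov₂) hci₂ hU hKU
    (fun j hj => by rw [e]; exact hKrU j hj) hg h1 h2 h3 h4 e3 (fun j hj x hx => e4 j hj x (by rwa [e] at hx))
  exact h

end

end Summit.AtomisticToContinuum.Crystallization.Theorems.OverbindingBudgetAffineFarFieldLedgerWindow
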